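import Summits.Ventures.HSemireg.SignedPureWeilLadder

/-!
# Venture HSemireg — the OPPOSITE slice pairs of a signed pure-Weil design: all six pairwise slice differences along one factor are
# pure and W-alive, and their supports are sandwiched between the symmetric difference and the union of the two slices (every n)

HONEST FRAMING. Part of the Lean index of the computation cell `pub-hsemireg` (Sunday typer seat p9, § g = 8; family B row **B20-3**
of `target-g8/CENSUS.md`: signed pure-Weil unit-graph designs are «class witnesses — cycles with ℤ-coefficients — not census objects»).
FINITE GAUSSIAN-INTEGER ARITHMETIC ONLY, in the vocabulary of `SignedPureWeilLadder.lean` (`Letter`, `Eps`, `vmoment`, `plus`, `minus`,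
`supp`, `sl`, `G`, `sliceSupp`, `four_mul_pair`). No abelian variety, cycle, sheaf or semiregularity map is constructed; t-20's dictionary
(LEMMA W) is text of record, not a binder; nothing here says that HC ∕ HC_CM ∕ HC_AV holds; no object is certified; no Literature fact
is declared; no verdict ∕ door word ∕ count of the cell moves.

CONTEXT. `SignedPureWeilLadder.lean` slices a design `m` on (ℤ∕4)ⁿ⁺¹ along factor 0 and proves that the four ADJACENT slice-pair
designs `sl m a = m(a,·) + m(a+1,·)` are pure (`sl_pure`) and W-alive (`sl_alive`) — LEMMA S. The exact-support census of
`HOME/p9/S5-LOWER-p9g8.md` (this seat: s(5) ≥ 61 machine) uses ALL SIX pairs: with the twisted slices p_t := (−1)^t m(t,·), every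
difference p_s − p_t (s ≠ t) is pure and W-alive, and supp p_s △ supp p_t ⊆ supp(p_s − p_t) ⊆ supp p_s ∪ supp p_t («sandwich»).
For adjacent pairs p_a − p_{a+1} = ±·sl m a; this file adds the OPPOSITE pairs p_a − p_{a+2} = ±·(m(a,·) − m(a+2,·)).

WHAT THIS FILE PROVES (every n). §1 `slOpp m a` (x' ↦ m(a,x') − m(a+2,x')), `vmoment_slOpp` (its moments are G(a) − G(a+2)),
the tables `pTab a = 2·i^{−a}`, `qTab a = 2·i^{a}` and the **OPPOSITE FOUR-POINT IDENTITY** `four_mul_opp`: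
`4·(G(a) − G(a+2)) = 2i^{−a}·m̂(+,ε') + 2i^{a}·m̂(−,ε')` (the characters `a₁ = 0` and the invisible `a₁ = 2` both cancel on opposite
slices); §2 **`slOpp_pure`** (m pure ⇒ every opposite slice difference pure) and **`slOpp_alive`** (n ≥ 1, m pure W-alive ⇒
`4·m̂_{slOpp a}(+,…,+) = 2i^{−a}·m̂(+,…,+) ≠ 0`); §3 the SANDWICHES for both kinds of pairs: `supp_sl_subset` ∕ `symmDiff_subset_supp_sl`
(adjacent) and `supp_slOpp_subset` ∕ `symmDiff_subset_supp_slOpp` (opposite): the support of the pair design contains the symmetric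
difference of the two slices and is contained in their union.

WHAT IS NOT HERE. The census itself (machine, `S5-LOWER-p9g8.md`); the exact value of s(5) (open in [61, 80] of record).
-/

namespace Summit.Ventures.HSemireg.SignedWeilDesignN

open Finset

variable {n : ℕ}

/-! ## §1 Opposite slice differences and their four-point identity -/

/-- The OPPOSITE slice-difference design on the remaining factors: `x' ↦ m(a, x') − m(a+2, x')`. [definition of this file] -/
def slOpp (m : Letter (n + 1) → ℤ) (a : Fin 4) : Letter n → ℤ := fun x' => m (Fin.cons a x') - m (Fin.cons (a + 2) x')

/-- The moments of the opposite slice difference: `m̂_{slOpp a}(ε') = G(a) − G(a+2)`. -/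
theorem vmoment_slOpp (m : Letter (n + 1) → ℤ) (a : Fin 4) (ε' : Eps n) :
    vmoment (slOpp m a) ε' = G m ε' a - G m ε' (a + 2) := by
  simp only [vmoment, slOpp, G, ← Finset.sum_sub_distrib]
  refine Finset.sum_congr rfl (fun x' _ => ?_)
  push_cast
  ring

/-- The unit `2·i^{−a}`, tabulated. [definition of this file] -/
def pTab : Fin 4 → GaussianInt := ![2, -⟨0, 2⟩, -2, ⟨0, 2⟩]

/-- The unit `2·i^{a}`, tabulated. [definition of this file] -/
def qTab : Fin 4 → GaussianInt := ![2, ⟨0, 2⟩, -2, -⟨0, 2⟩]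

/-- `pTab a ≠ 0`. -/
theorem pTab_ne_zero : ∀ a : Fin 4, pTab a ≠ 0 := by decide

/-- **THE OPPOSITE FOUR-POINT IDENTITY:** `4·(G(a) − G(a+2)) = 2i^{−a}·m̂(+,ε') + 2i^{a}·m̂(−,ε')` — on opposite slices the characters
`a₁ = 0` and `a₁ = 2` (the invisible one) both cancel. -/
theorem four_mul_opp (m : Letter (n + 1) → ℤ) (ε' : Eps n) (a : Fin 4) :
    4 * (G m ε' a - G m ε' (a + 2)) = pTab a * vmoment m (Fin.cons 1 ε') + qTab a * vmoment m (Fin.cons 2 ε') := by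
  rw [vmoment_cons, vmoment_cons]
  simp only [Fin.sum_univ_four]
  fin_cases a <;> simp [unitTab, pTab, qTab, coef] <;> (ext <;> simp <;> ring)

/-! ## §2 Opposite slice differences of a pure (W-alive) design are pure (W-alive) -/

/-- **OPPOSITE SLICE DIFFERENCES OF A PURE DESIGN ARE PURE.** -/
theorem slOpp_pure (m : Letter (n + 1) → ℤ)
    (hpure : ∀ ε : Eps (n + 1), ε ≠ plus → ε ≠ minus → vmoment m ε = 0) (a : Fin 4) :
    ∀ ε' : Eps n, ε' ≠ plus → ε' ≠ minus → vmoment (slOpp m a) ε' = 0 := by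
  intro ε' hp hm
  have h4 := four_mul_opp m ε' a
  rw [hpure _ (cons_ne_plus_of_ne 1 ε' hp) (cons_ne_minus_of_ne 1 ε' hm),
    hpure _ (cons_ne_plus_of_ne 2 ε' hp) (cons_ne_minus_of_ne 2 ε' hm)] at h4
  simp only [mul_zero, add_zero] at h4
  rw [vmoment_slOpp]
  rcases mul_eq_zero.mp h4 with h | h
  · exact absurd h (by norm_num)
  · exact h

/-- **OPPOSITE SLICE DIFFERENCES OF A PURE W-ALIVE DESIGN ARE W-ALIVE** (n ≥ 1, so that the pattern (−,+,…,+) is visible):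
`4·m̂_{slOpp a}(+,…,+) = 2i^{−a}·m̂(+,…,+) ≠ 0`. -/
theorem slOpp_alive (hn : 0 < n) (m : Letter (n + 1) → ℤ)
    (hpure : ∀ ε : Eps (n + 1), ε ≠ plus → ε ≠ minus → vmoment m ε = 0) (halive : vmoment m plus ≠ 0) (a : Fin 4) :
    vmoment (slOpp m a) plus ≠ 0 := by
  have h4 := four_mul_opp m plus a
  have h2p : (Fin.cons 2 (plus : Eps n) : Eps (n + 1)) ≠ plus := by
    intro hc; have := congrFun hc 0; simp [plus] at this
  have h2m : (Fin.cons 2 (plus : Eps n) : Eps (n + 1)) ≠ minus := by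
    intro hc
    have := congrFun hc (Fin.succ ⟨0, hn⟩)
    rw [Fin.cons_succ] at this
    simp [plus, minus] at this
  rw [hpure _ h2p h2m, cons_one_plus, mul_zero, add_zero] at h4
  intro hzero
  rw [vmoment_slOpp] at hzero
  rw [hzero, mul_zero] at h4
  rcases mul_eq_zero.mp h4.symm with h | h
  · exact pTab_ne_zero a h
  · exact halive h

/-! ## §3 The sandwiches: symmetric difference ⊆ support of the pair design ⊆ union of the two slices -/

/-- The support of an adjacent slice-pair design lies in the union of the two slices. -/
theorem supp_sl_subset (m : Letter (n + 1) → ℤ) (a : Fin 4) :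
    supp (sl m a) ⊆ sliceSupp m a ∪ sliceSupp m (a + 1) := by
  intro x' hx
  have hx' : sl m a x' ≠ 0 := (Finset.mem_filter.mp hx).2
  rw [Finset.mem_union]
  by_cases h1 : m (Fin.cons a x') = 0
  · right
    refine Finset.mem_filter.mpr ⟨Finset.mem_univ _, ?_⟩
    intro h2
    apply hx'
    simp [sl, h1, h2]
  · left
    exact Finset.mem_filter.mpr ⟨Finset.mem_univ _, h1⟩

/-- The support of an adjacent slice-pair design contains the symmetric difference of the two slices. -/
theorem symmDiff_subset_supp_sl (m : Letter (n + 1) → ℤ) (a : Fin 4) :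
    symmDiff (sliceSupp m a) (sliceSupp m (a + 1)) ⊆ supp (sl m a) := by
  intro x' hx
  rw [Finset.mem_symmDiff] at hx
  refine Finset.mem_filter.mpr ⟨Finset.mem_univ _, ?_⟩
  simp only [sliceSupp, Finset.mem_filter, Finset.mem_univ, true_and, not_not] at hx
  simp only [sl]
  rcases hx with ⟨h1, h2⟩ | ⟨h1, h2⟩
  · rw [h2, add_zero]; exact h1
  · rw [h2, zero_add]; exact h1

/-- The support of an opposite slice-difference design lies in the union of the two slices. -/
theorem supp_slOpp_subset (m : Letter (n + 1) → ℤ) (a : Fin 4) :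
    supp (slOpp m a) ⊆ sliceSupp m a ∪ sliceSupp m (a + 2) := by
  intro x' hx
  have hx' : slOpp m a x' ≠ 0 := (Finset.mem_filter.mp hx).2
  rw [Finset.mem_union]
  by_cases h1 : m (Fin.cons a x') = 0
  · right
    refine Finset.mem_filter.mpr ⟨Finset.mem_univ _, ?_⟩
    intro h2
    apply hx'
    simp [slOpp, h1, h2]
  · left
    exact Finset.mem_filter.mpr ⟨Finset.mem_univ _, h1⟩

/-- The support of an opposite slice-difference design contains the symmetric difference of the two slices. -/
theorem symmDiff_subset_supp_slOpp (m : Letter (n + 1) → ℤ) (a : Fin 4) :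
    symmDiff (sliceSupp m a) (sliceSupp m (a + 2)) ⊆ supp (slOpp m a) := by
  intro x' hx
  rw [Finset.mem_symmDiff] at hx
  refine Finset.mem_filter.mpr ⟨Finset.mem_univ _, ?_⟩
  simp only [sliceSupp, Finset.mem_filter, Finset.mem_univ, true_and, not_not] at hx
  simp only [slOpp]
  rcases hx with ⟨h1, h2⟩ | ⟨h1, h2⟩
  · rw [h2, sub_zero]; exact h1
  · rw [h2, zero_sub]; exact neg_ne_zero.mpr h1

/-- **ALL SIX PAIRS AT ONCE (the form the census uses):** for a pure W-alive design on (ℤ∕4)ⁿ⁺¹ (n ≥ 1) and every `a`, both the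
adjacent pair design `sl m a` and the opposite pair design `slOpp m a` are pure and W-alive on (ℤ∕4)ⁿ, with supports sandwiched
between the symmetric difference and the union of the two slices. -/
theorem slice_pairs (hn : 0 < n) (m : Letter (n + 1) → ℤ)
    (hpure : ∀ ε : Eps (n + 1), ε ≠ plus → ε ≠ minus → vmoment m ε = 0) (halive : vmoment m plus ≠ 0) (a : Fin 4) :
    ((∀ ε' : Eps n, ε' ≠ plus → ε' ≠ minus → vmoment (sl m a) ε' = 0) ∧ vmoment (sl m a) plus ≠ 0 ∧
        symmDiff (sliceSupp m a) (sliceSupp m (a + 1)) ⊆ supp (sl m a) ∧ supp (sl m a) ⊆ sliceSupp m a ∪ sliceSupp m (a + 1)) ∧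
    ((∀ ε' : Eps n, ε' ≠ plus → ε' ≠ minus → vmoment (slOpp m a) ε' = 0) ∧ vmoment (slOpp m a) plus ≠ 0 ∧
        symmDiff (sliceSupp m a) (sliceSupp m (a + 2)) ⊆ supp (slOpp m a) ∧ supp (slOpp m a) ⊆ sliceSupp m a ∪ sliceSupp m (a + 2)) :=
  ⟨⟨sl_pure m hpure a, sl_alive hn m hpure halive a, symmDiff_subset_supp_sl m a, supp_sl_subset m a⟩,
    ⟨slOpp_pure m hpure a, slOpp_alive hn m hpure halive a, symmDiff_subset_supp_slOpp m a, supp_slOpp_subset m a⟩⟩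

end Summit.Ventures.HSemireg.SignedWeilDesignN
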